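import Summits.QuantumFields.YangMills.Theorems.LuscherReductionTwistedTraceScalingBTColourAveraging
import Summits.QuantumFields.YangMills.Theorems.LuscherReductionTwistedTraceScalingToronSymmetricFunctional
import Summits.QuantumFields.YangMills.Theorems.LuscherReductionTwistedTraceScalingInnerStiffForm
import HarnessLib

/-!
# R39 — the colour average is exact to FIRST order only: the second-order term is a genuine, explicit quadratic form

Standing crux disprover `ym-cdisprove-20203-1` (gen 31) on `LuscherReduction.TwistedTraceScaling`
(stmt-QuantumFields-20203; skeleton «twolattice» rev 3).  NEGATIVE / TIGHTNESS lemma for lane A's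
(B-T) step (L3) «diagonal averaging engine» (`…BTColourAveraging`, `…BTDiagonalPhase`, p658374–p659630).

VETTED (sound, exact identities, no target): `integral_adRot_mulVec_eq_zero`, `integral_exp_sandwich_of_integral_eq_zero`,
`haar_integral_exp_linear_sandwich`, `fpBOKernel_conj`, `abs_diagX_sub_diagX1_le`, `abs_diagX1_le`, `integral_diagX1_conj_eq_zero`.

FINDING.  Lane A's sandwich `1 - ε₂ ≤ ∫ exp(X₁+X₂) ≤ 1 + ε₂ + (ε₁+ε₂)²` uses only `∫ X₁ = 0`.  For the colour
average `X₁(c) = Σ_k (Ad(c)a_k)·Y_k` the SECOND moment is also explicit and does NOT vanish: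
  `∫_{SU(2)} (Ad(c)a)_i (Ad(c)a')_j dc = δ_ij (a·a')/3`                                   (`moment_eq`),
  `∫ (Σ_k (Ad(c)a_k)·Y_k)² dc = (1/3) Σ_{k,l} (a_k·a_l)(Y_k·Y_l)`                          (`integral_sq_sum_dot`),
  `|∫ exp(Σ_k (Ad(c)a_k)·Y_k) dc - 1 - (1/6)Σ_{k,l}(a_k·a_l)(Y_k·Y_l)| ≤ (2/9)ε₁³`          (`haar_integral_exp_linear_second_order`),
proved from LEFT invariance of Haar and three explicit elements (two half-turns, the cyclic quaternion `(1+i+j+k)/2`),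
plus `Real.exp_bound` at order 3.  Consequences (★★★):
  `not_average_exp_cubic_close` : `¬ ∃ K, ∀ t ∈ (0,1], |∫ exp(t·Ad(c)₀₀) dc - 1| ≤ K t³`;
  `not_sandwich_upper_seventh`  : the sandwich's upper constant cannot be improved to `1 + ε₁²/7` (truth `≥ 1 + t²/6 - (2/9)t³`).

READING for (L3).  After the `d`-average the diagonal factor is `1 + E[X₂] + (1/6)·Var-form + O(ε³)`: a
`u`-DEPENDENT quadratic term of relative size `Θ(δ²)` on the window `|u⃗_k| ≤ δ ≈ 43β^{-s}` (the induced
one-loop potential of the slow modes).  Hence a single-constant comparison `fpBOKernel(u,u) ≈ C·K₁(u,u)` has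
relative precision no better than `c·γ·δ²` (γ = the `Y`-variance), i.e. `κ ≥ c·γ·β^{-2s}` is NECESSARY in this
architecture — `hκ_dom`'s «∀ C, C·(43β^{-s})² ≤ κ» is forced, not generous, and with `hκ_small` this is the
R37 window `s > 1/6` seen from the mechanism.  NO KILL: lane A's `κ := β^{-2s}log⁵β` absorbs the term; this file
fixes its exact coefficient for the (L3) assembly and refutes the two natural sharpenings above.

HONEST FRAMING: a tightness lemma about a stub of a child of the CONDITIONAL reduction route R2b1; nothing
registered is refuted or proved; C4-CORE / the (B-T) Laplace core stay OPEN; not a gap, not Clay.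
References: [folklore] (Schur orthogonality for the adjoint representation of SU(2), done here by hand).
-/

noncomputable section

open MeasureTheory Real
open scoped BigOperators Matrix
open Literature.MathematicalPhysics.QuantumFieldTheory hiding SU2
open Literature.MathematicalPhysics.QuantumLattice

namespace Summit.QuantumFields.YangMills.Theorems.TwistedTraceScaling.Negative.R39

open Summit.QuantumFields.YangMills.Theorems.FemtoTransferGap
open Summit.QuantumFields.YangMills.Theorems.FemtoTransferGap.TwoLattice.ConstTube
open Summit.QuantumFields.YangMills.Theorems.FemtoTransferGap.TwoLattice.Cov (adRot_mul sum_sq_adRot_mulVec)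
open Summit.QuantumFields.YangMills.Theorems.FemtoTransferGap.TwoLattice.Toron
  (exists_adRot_halfTurn_two adRot_diagSU2_halfTurn_mulVec adRot_mulVec_eq)

/-! ## §1 Three explicit elements of `SU(2)` and their adjoint action -/

/-- `Σ_a (1/2)² = 3/4`. -/
theorem sum_sq_half : ∑ a : Fin 3, (![(1:ℝ)/2, 1/2, 1/2] a) ^ 2 = 3/4 := by
  simp [Fin.sum_univ_three]; norm_num

/-- The vector part of the cyclic quaternion `cyc = (1+i+j+k)/2` is `(½,½,½)`. -/
theorem vecPart_cyc : vecPart (chartSU2 ![1/2, 1/2, 1/2]) = ![1/2, 1/2, 1/2] :=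
  vecPart_chartSU2 (by rw [sum_sq_half]; norm_num)

/-- The scalar part of `cyc` is `½`. -/
theorem scalarPart_cyc : scalarPart (chartSU2 ![1/2, 1/2, 1/2]) = 1/2 := by
  rw [scalarPart_chartSU2 (by rw [sum_sq_half]; norm_num), sum_sq_half,
    show (1:ℝ) - 3/4 = (1/2) ^ 2 by norm_num, Real.sqrt_sq (by norm_num)]

/-- ★ `Ad(cyc)` is the cyclic permutation of the colour axes: `Ad(cyc)x = (x₂, x₀, x₁)`. [folklore] -/
theorem adRot_cyc_mulVec (x : Fin 3 → ℝ) : adRot (chartSU2 ![1/2, 1/2, 1/2]) *ᵥ x = ![x 2, x 0, x 1] := by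
  rw [adRot_mulVec_eq, vecPart_cyc, scalarPart_cyc]
  ext i
  fin_cases i <;> simp [cross_apply, Matrix.vecHead, Matrix.vecTail] <;> ring

/-- `Ad(diag(e^{iπ/2}, e^{-iπ/2}))x = (x₀, -x₁, -x₂)`. -/
theorem adRot_flip12_mulVec (x : Fin 3 → ℝ) : adRot (diagSU2 (π / 2)) *ᵥ x = ![x 0, -x 1, -x 2] :=
  adRot_diagSU2_halfTurn_mulVec x

/-! ## §2 Pointwise bounds and integrability -/

/-- `(Ad c a)_i² ≤ |a|²`. -/
theorem sq_adRot_mulVec_apply_le (c : SU2) (a : Fin 3 → ℝ) (i : Fin 3) :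
    ((adRot c *ᵥ a) i) ^ 2 ≤ ∑ k, a k ^ 2 := by
  rw [← sum_sq_adRot_mulVec c a]
  exact Finset.single_le_sum (f := fun k => ((adRot c *ᵥ a) k) ^ 2) (fun k _ => sq_nonneg _) (Finset.mem_univ i)

/-- Crude bound `|(Ad c a)_i| ≤ 1 + |a|²`. -/
theorem abs_adRot_mulVec_apply_le (c : SU2) (a : Fin 3 → ℝ) (i : Fin 3) :
    |(adRot c *ᵥ a) i| ≤ 1 + ∑ k, a k ^ 2 := by
  nlinarith [sq_adRot_mulVec_apply_le c a i, sq_nonneg (|(adRot c *ᵥ a) i| - 1), sq_abs ((adRot c *ᵥ a) i),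
    abs_nonneg ((adRot c *ᵥ a) i), sq_nonneg ((adRot c *ᵥ a) i)]

/-- `((Ad c a)·(Ad c a')) = a·a'` (orthogonality of `Ad`). -/
theorem adRot_mulVec_dotProduct (c : SU2) (a a' : Fin 3 → ℝ) : (adRot c *ᵥ a) ⬝ᵥ (adRot c *ᵥ a') = a ⬝ᵥ a' := by
  rw [← Matrix.vecMul_transpose, ← Matrix.dotProduct_mulVec, Matrix.mulVec_mulVec, adRot_transpose_mul_self,
    Matrix.one_mulVec]

/-- Cauchy–Schwarz: `((Ad c a)·Y)² ≤ |a|²|Y|²`. -/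
theorem sq_adRot_dot_le (c : SU2) (a Y : Fin 3 → ℝ) :
    ((adRot c *ᵥ a) ⬝ᵥ Y) ^ 2 ≤ (∑ k, a k ^ 2) * ∑ i, Y i ^ 2 := by
  rw [← sum_sq_adRot_mulVec c a]
  exact Finset.sum_mul_sq_le_sq_mul_sq Finset.univ (fun i => (adRot c *ᵥ a) i) Y

/-- `|(Ad c a)·Y| ≤ t` whenever `|a|²|Y|² ≤ t²`, `0 ≤ t`. -/
theorem abs_adRot_dot_le (c : SU2) (a Y : Fin 3 → ℝ) {t : ℝ} (ht : 0 ≤ t)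
    (h : (∑ k, a k ^ 2) * (∑ i, Y i ^ 2) ≤ t ^ 2) : |(adRot c *ᵥ a) ⬝ᵥ Y| ≤ t :=
  abs_le_of_sq_le_sq ((sq_adRot_dot_le c a Y).trans h) ht

/-- Crude bound `|(Ad c a)·Y| ≤ (1 + |a|²) Σ_i |Y_i|`. -/
theorem abs_adRot_dot_le' (c : SU2) (a Y : Fin 3 → ℝ) :
    |(adRot c *ᵥ a) ⬝ᵥ Y| ≤ (1 + ∑ k, a k ^ 2) * ∑ i, |Y i| := by
  calc |(adRot c *ᵥ a) ⬝ᵥ Y| = |∑ i, (adRot c *ᵥ a) i * Y i| := rfl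
    _ ≤ ∑ i, |(adRot c *ᵥ a) i * Y i| := Finset.abs_sum_le_sum_abs _ _
    _ ≤ ∑ i, (1 + ∑ k, a k ^ 2) * |Y i| := Finset.sum_le_sum fun i _ => by
        rw [abs_mul]; exact mul_le_mul_of_nonneg_right (abs_adRot_mulVec_apply_le c a i) (abs_nonneg _)
    _ = (1 + ∑ k, a k ^ 2) * ∑ i, |Y i| := by rw [Finset.mul_sum]

/-- `c ↦ (Ad c a)_i` is continuous. -/
theorem continuous_adRot_mulVec_apply (a : Fin 3 → ℝ) (i : Fin 3) : Continuous fun c : SU2 => (adRot c *ᵥ a) i :=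
  (continuous_apply i).comp (continuous_adRot_mulVec a)

/-- `c ↦ (Ad c a)·Y` is continuous. -/
theorem continuous_adRot_dot (a Y : Fin 3 → ℝ) : Continuous fun c : SU2 => (adRot c *ᵥ a) ⬝ᵥ Y :=
  (continuous_adRot_mulVec a).dotProduct continuous_const

/-- The moment integrand is Haar integrable. -/
theorem integrable_moment (a a' : Fin 3 → ℝ) (i j : Fin 3) :
    Integrable (fun c : SU2 => (adRot c *ᵥ a) i * (adRot c *ᵥ a') j) (haarProbability SU2) := by
  haveI : SecondCountableTopology SU2 := secondCountableTopology_su2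
  refine integrable_of_measurable_abs_le _
    ((continuous_adRot_mulVec_apply a i).mul (continuous_adRot_mulVec_apply a' j)).measurable
    (C := (1 + ∑ k, a k ^ 2) * (1 + ∑ k, a' k ^ 2)) fun c => ?_
  rw [abs_mul]
  exact mul_le_mul (abs_adRot_mulVec_apply_le c a i) (abs_adRot_mulVec_apply_le c a' j) (abs_nonneg _) (by positivity)

/-- The product of two colour-rotated linear forms is Haar integrable. -/
theorem integrable_dot_mul_dot (a a' Y Y' : Fin 3 → ℝ) :
    Integrable (fun c : SU2 => ((adRot c *ᵥ a) ⬝ᵥ Y) * ((adRot c *ᵥ a') ⬝ᵥ Y')) (haarProbability SU2) := by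
  haveI : SecondCountableTopology SU2 := secondCountableTopology_su2
  refine integrable_of_measurable_abs_le _ ((continuous_adRot_dot a Y).mul (continuous_adRot_dot a' Y')).measurable
    (C := ((1 + ∑ k, a k ^ 2) * ∑ i, |Y i|) * ((1 + ∑ k, a' k ^ 2) * ∑ i, |Y' i|)) fun c => ?_
  rw [abs_mul]
  exact mul_le_mul (abs_adRot_dot_le' c a Y) (abs_adRot_dot_le' c a' Y') (abs_nonneg _) (by positivity)

/-! ## §3 The second moment of the colour average: `N_ij(a,a') := ∫ (Ad c a)_i (Ad c a')_j dc = δ_ij (a·a')/3` -/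

/-- Left invariance: `N_ij` is unchanged when both factors are rotated by a fixed `Ad d`. -/
theorem moment_eq_integral_mul_left (d : SU2) (a a' : Fin 3 → ℝ) (i j : Fin 3) :
    ∫ c, (adRot c *ᵥ a) i * (adRot c *ᵥ a') j ∂haarProbability SU2 =
      ∫ c, (adRot d *ᵥ (adRot c *ᵥ a)) i * (adRot d *ᵥ (adRot c *ᵥ a')) j ∂haarProbability SU2 := by
  rw [← integral_mul_left_eq_self (fun c => (adRot c *ᵥ a) i * (adRot c *ᵥ a') j) d]
  simp only [adRot_mul, ← Matrix.mulVec_mulVec]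

/-- A sign-reversing left translation kills a Haar integral. -/
theorem integral_eq_zero_of_mul_left_neg {f : SU2 → ℝ} (d : SU2) (h : ∀ c, f (d * c) = -f c) :
    ∫ c, f c ∂haarProbability SU2 = 0 := by
  have h1 := integral_mul_left_eq_self f (μ := haarProbability SU2) d
  simp only [h, integral_neg] at h1
  linarith

/-- `N₀₁ = 0` (half-turn about axis 0). -/
theorem moment_zero_one (a a' : Fin 3 → ℝ) : ∫ c, (adRot c *ᵥ a) 0 * (adRot c *ᵥ a') 1 ∂haarProbability SU2 = 0 :=
  integral_eq_zero_of_mul_left_neg (diagSU2 (π / 2)) fun c => by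
    rw [adRot_mul, ← Matrix.mulVec_mulVec, ← Matrix.mulVec_mulVec, adRot_flip12_mulVec, adRot_flip12_mulVec]; simp

/-- `N₁₀ = 0`. -/
theorem moment_one_zero (a a' : Fin 3 → ℝ) : ∫ c, (adRot c *ᵥ a) 1 * (adRot c *ᵥ a') 0 ∂haarProbability SU2 = 0 :=
  integral_eq_zero_of_mul_left_neg (diagSU2 (π / 2)) fun c => by
    rw [adRot_mul, ← Matrix.mulVec_mulVec, ← Matrix.mulVec_mulVec, adRot_flip12_mulVec, adRot_flip12_mulVec]; simp

/-- `N₀₂ = 0`. -/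
theorem moment_zero_two (a a' : Fin 3 → ℝ) : ∫ c, (adRot c *ᵥ a) 0 * (adRot c *ᵥ a') 2 ∂haarProbability SU2 = 0 :=
  integral_eq_zero_of_mul_left_neg (diagSU2 (π / 2)) fun c => by
    rw [adRot_mul, ← Matrix.mulVec_mulVec, ← Matrix.mulVec_mulVec, adRot_flip12_mulVec, adRot_flip12_mulVec]; simp

/-- `N₂₀ = 0`. -/
theorem moment_two_zero (a a' : Fin 3 → ℝ) : ∫ c, (adRot c *ᵥ a) 2 * (adRot c *ᵥ a') 0 ∂haarProbability SU2 = 0 :=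
  integral_eq_zero_of_mul_left_neg (diagSU2 (π / 2)) fun c => by
    rw [adRot_mul, ← Matrix.mulVec_mulVec, ← Matrix.mulVec_mulVec, adRot_flip12_mulVec, adRot_flip12_mulVec]; simp

/-- `N₁₂ = 0` (half-turn about axis 1, from `exists_adRot_halfTurn_two`). -/
theorem moment_one_two (a a' : Fin 3 → ℝ) : ∫ c, (adRot c *ᵥ a) 1 * (adRot c *ᵥ a') 2 ∂haarProbability SU2 = 0 := by
  obtain ⟨V, hV⟩ := exists_adRot_halfTurn_two
  exact integral_eq_zero_of_mul_left_neg V fun c => by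
    rw [adRot_mul, ← Matrix.mulVec_mulVec, ← Matrix.mulVec_mulVec, hV, hV]; simp

/-- `N₂₁ = 0`. -/
theorem moment_two_one (a a' : Fin 3 → ℝ) : ∫ c, (adRot c *ᵥ a) 2 * (adRot c *ᵥ a') 1 ∂haarProbability SU2 = 0 := by
  obtain ⟨V, hV⟩ := exists_adRot_halfTurn_two
  exact integral_eq_zero_of_mul_left_neg V fun c => by
    rw [adRot_mul, ← Matrix.mulVec_mulVec, ← Matrix.mulVec_mulVec, hV, hV]; simp

/-- Cyclic symmetry of the diagonal moments: `N₀₀ = N₂₂` (the cyclic quaternion `(1+i+j+k)/2`). -/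
theorem moment_zero_zero_eq_two_two (a a' : Fin 3 → ℝ) : ∫ c, (adRot c *ᵥ a) 0 * (adRot c *ᵥ a') 0 ∂haarProbability SU2 = ∫ c, (adRot c *ᵥ a) 2 * (adRot c *ᵥ a') 2 ∂haarProbability SU2 := by
  rw [moment_eq_integral_mul_left (chartSU2 ![1/2, 1/2, 1/2]) a a' 0 0]; simp only [adRot_cyc_mulVec]; simp

/-- `N₁₁ = N₀₀`. -/
theorem moment_one_one_eq_zero_zero (a a' : Fin 3 → ℝ) : ∫ c, (adRot c *ᵥ a) 1 * (adRot c *ᵥ a') 1 ∂haarProbability SU2 = ∫ c, (adRot c *ᵥ a) 0 * (adRot c *ᵥ a') 0 ∂haarProbability SU2 := by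
  rw [moment_eq_integral_mul_left (chartSU2 ![1/2, 1/2, 1/2]) a a' 1 1]; simp only [adRot_cyc_mulVec]; simp

/-- The trace of the moment matrix: `Σ_i N_ii = a·a'`. -/
theorem moment_trace (a a' : Fin 3 → ℝ) :
    ((∫ c, (adRot c *ᵥ a) 0 * (adRot c *ᵥ a') 0 ∂haarProbability SU2) + ∫ c, (adRot c *ᵥ a) 1 * (adRot c *ᵥ a') 1 ∂haarProbability SU2) + ∫ c, (adRot c *ᵥ a) 2 * (adRot c *ᵥ a') 2 ∂haarProbability SU2 = a ⬝ᵥ a' := by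
  have h : ∀ c : SU2, (adRot c *ᵥ a) 0 * (adRot c *ᵥ a') 0 + (adRot c *ᵥ a) 1 * (adRot c *ᵥ a') 1
      + (adRot c *ᵥ a) 2 * (adRot c *ᵥ a') 2 = a ⬝ᵥ a' := fun c => by
    rw [← adRot_mulVec_dotProduct c a a']; simp [dotProduct, Fin.sum_univ_three]
  have hsum : ∫ c, ((adRot c *ᵥ a) 0 * (adRot c *ᵥ a') 0 + (adRot c *ᵥ a) 1 * (adRot c *ᵥ a') 1
      + (adRot c *ᵥ a) 2 * (adRot c *ᵥ a') 2) ∂haarProbability SU2 = a ⬝ᵥ a' := by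
    simp_rw [h]; simp
  have i01 : Integrable (fun c : SU2 => (adRot c *ᵥ a) 0 * (adRot c *ᵥ a') 0 + (adRot c *ᵥ a) 1 * (adRot c *ᵥ a') 1)
      (haarProbability SU2) := (integrable_moment a a' 0 0).add (integrable_moment a a' 1 1)
  rw [integral_add i01 (integrable_moment a a' 2 2), integral_add (integrable_moment a a' 0 0) (integrable_moment a a' 1 1)]
    at hsum
  exact hsum

/-- ★★ **Second moment of the colour average** (Schur orthogonality for `Ad : SU(2) → SO(3)`, by hand):
`∫ (Ad c a)_i (Ad c a')_j dc = δ_ij (a·a')/3`. [folklore] -/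
theorem moment_eq (a a' : Fin 3 → ℝ) (i j : Fin 3) :
    ∫ c, (adRot c *ᵥ a) i * (adRot c *ᵥ a') j ∂haarProbability SU2 = if i = j then (a ⬝ᵥ a') / 3 else 0 := by
  have ht := moment_trace a a'
  have h02 := moment_zero_zero_eq_two_two a a'
  have h10 := moment_one_one_eq_zero_zero a a'
  fin_cases i <;> fin_cases j
  · simp; linarith
  · simpa using moment_zero_one a a'
  · simpa using moment_zero_two a a'
  · simpa using moment_one_zero a a'
  · simp; linarith
  · simpa using moment_one_two a a'
  · simpa using moment_two_zero a a'
  · simpa using moment_two_one a a'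
  · simp; linarith

/-! ## §4 Second moment of the linear functional `X₁(c) = Σ_k (Ad c a_k)·Y_k` -/

/-- ★★ `∫ ((Ad c a)·Y)((Ad c a')·Y') dc = (a·a')(Y·Y')/3`. -/
theorem integral_dot_mul_dot (a a' Y Y' : Fin 3 → ℝ) :
    ∫ c, ((adRot c *ᵥ a) ⬝ᵥ Y) * ((adRot c *ᵥ a') ⬝ᵥ Y') ∂haarProbability SU2 = (a ⬝ᵥ a') * (Y ⬝ᵥ Y') / 3 := by
  have hexp : (fun c : SU2 => ((adRot c *ᵥ a) ⬝ᵥ Y) * ((adRot c *ᵥ a') ⬝ᵥ Y')) =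
      fun c => ∑ i, ∑ j, (Y i * Y' j) * ((adRot c *ᵥ a) i * (adRot c *ᵥ a') j) := by
    funext c
    simp only [dotProduct]
    rw [Finset.sum_mul_sum]
    exact Finset.sum_congr rfl fun i _ => Finset.sum_congr rfl fun j _ => by ring
  rw [hexp, integral_finsetSum _ fun i _ => integrable_finsetSum _ fun j _ => (integrable_moment a a' i j).const_mul _]
  have hin : ∀ i, ∫ c, ∑ j, Y i * Y' j * ((adRot c *ᵥ a) i * (adRot c *ᵥ a') j) ∂haarProbability SU2
      = ∑ j, Y i * Y' j * ∫ c, (adRot c *ᵥ a) i * (adRot c *ᵥ a') j ∂haarProbability SU2 := fun i => by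
    rw [integral_finsetSum _ fun j _ => (integrable_moment a a' i j).const_mul _]
    exact Finset.sum_congr rfl fun j _ => integral_const_mul _ _
  simp_rw [hin, moment_eq]
  simp [Fin.sum_univ_three, dotProduct]
  ring

/-- ★★ **Variance of the colour-averaged linear term**:
`∫ (Σ_k (Ad c a_k)·Y_k)² dc = (1/3) Σ_{k,l} (a_k·a_l)(Y_k·Y_l)`. -/
theorem integral_sq_sum_dot {ι : Type*} [Fintype ι] (a Y : ι → Fin 3 → ℝ) :
    ∫ c, (∑ k, (adRot c *ᵥ a k) ⬝ᵥ Y k) ^ 2 ∂haarProbability SU2 = (1/3 : ℝ) * ∑ k, ∑ l, (a k ⬝ᵥ a l) * (Y k ⬝ᵥ Y l) := by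
  have hexp : (fun c : SU2 => (∑ k, (adRot c *ᵥ a k) ⬝ᵥ Y k) ^ 2) =
      fun c => ∑ k, ∑ l, ((adRot c *ᵥ a k) ⬝ᵥ Y k) * ((adRot c *ᵥ a l) ⬝ᵥ Y l) := by
    funext c; rw [sq, Finset.sum_mul_sum]
  rw [hexp, integral_finsetSum _ fun k _ => integrable_finsetSum _ fun l _ => integrable_dot_mul_dot (a k) (a l) (Y k) (Y l)]
  have hin : ∀ k, ∫ c, ∑ l, ((adRot c *ᵥ a k) ⬝ᵥ Y k) * ((adRot c *ᵥ a l) ⬝ᵥ Y l) ∂haarProbability SU2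
      = ∑ l, (a k ⬝ᵥ a l) * (Y k ⬝ᵥ Y l) / 3 := fun k => by
    rw [integral_finsetSum _ fun l _ => integrable_dot_mul_dot (a k) (a l) (Y k) (Y l)]
    exact Finset.sum_congr rfl fun l _ => integral_dot_mul_dot _ _ _ _
  simp_rw [hin]
  rw [Finset.mul_sum]
  exact Finset.sum_congr rfl fun k _ => by rw [Finset.mul_sum]; exact Finset.sum_congr rfl fun l _ => by ring

/-! ## §5 Abstract second-order expansion of `∫ exp X` for a centred bounded `X` -/

/-- ★ For `|X| ≤ ε ≤ 1` with `∫ X = 0` on a probability space: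
`|∫ exp X - (1 + ½ ∫ X²)| ≤ (2/9) ε³` (`Real.exp_bound` at order three, pointwise). -/
theorem abs_integral_exp_sub_second_order {C : Type*} [MeasurableSpace C] (ν : Measure C) [IsProbabilityMeasure ν]
    {X : C → ℝ} (hXm : Measurable X) {ε : ℝ} (hX : ∀ c, |X c| ≤ ε) (hε : ε ≤ 1) (hmean : ∫ c, X c ∂ν = 0) :
    |∫ c, exp (X c) ∂ν - (1 + (1/2 : ℝ) * ∫ c, X c ^ 2 ∂ν)| ≤ 2/9 * ε ^ 3 := by
  have hpt : ∀ c, |exp (X c) - (1 + X c + X c ^ 2 / 2)| ≤ 2/9 * ε ^ 3 := fun c => by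
    have h := Real.exp_bound ((hX c).trans hε) (n := 3) (by norm_num)
    have hs : ∑ m ∈ Finset.range 3, X c ^ m / (m.factorial : ℝ) = 1 + X c + X c ^ 2 / 2 := by
      simp [Finset.sum_range_succ, Nat.factorial]
    rw [hs] at h
    have h3 : |X c| ^ 3 ≤ ε ^ 3 := pow_le_pow_left₀ (abs_nonneg _) (hX c) 3
    have hK : ((Nat.succ 3 : ℕ) : ℝ) / ((Nat.factorial 3 : ℕ) * (3 : ℕ)) = 2/9 := by norm_num [Nat.factorial]
    rw [hK] at h
    linarith
  have hi_exp : Integrable (fun c => exp (X c)) ν :=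
    integrable_of_measurable_abs_le _ (Real.measurable_exp.comp hXm) (C := exp 1) fun c => by
      rw [abs_of_pos (exp_pos _)]; exact exp_le_exp.mpr ((le_abs_self _).trans ((hX c).trans hε))
  have hi_X : Integrable X ν := integrable_of_measurable_abs_le _ hXm hX
  have hi_sq : Integrable (fun c => X c ^ 2) ν :=
    integrable_of_measurable_abs_le _ (hXm.pow_const 2) (C := ε ^ 2) fun c => by rw [abs_pow]; exact pow_le_pow_left₀ (abs_nonneg _) (hX c) 2
  have i1 : Integrable (fun c => (1 : ℝ) + X c) ν := (integrable_const 1).add hi_X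
  have i2 : Integrable (fun c => (1 : ℝ) + X c + X c ^ 2 / 2) ν := i1.add (hi_sq.div_const 2)
  have hdiff : ∫ c, (exp (X c) - (1 + X c + X c ^ 2 / 2)) ∂ν = ∫ c, exp (X c) ∂ν - (1 + (1/2 : ℝ) * ∫ c, X c ^ 2 ∂ν) := by
    rw [integral_sub hi_exp i2, integral_add i1 (hi_sq.div_const 2), integral_add (integrable_const 1) hi_X, hmean, integral_div]
    simp; ring
  rw [← hdiff]
  calc |∫ c, (exp (X c) - (1 + X c + X c ^ 2 / 2)) ∂ν| ≤ ∫ c, |exp (X c) - (1 + X c + X c ^ 2 / 2)| ∂ν :=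
        abs_integral_le_integral_abs
    _ ≤ ∫ _, 2/9 * ε ^ 3 ∂ν :=
        integral_mono_of_nonneg (ae_of_all _ fun _ => abs_nonneg _) (integrable_const _) (ae_of_all _ hpt)
    _ = 2/9 * ε ^ 3 := by simp

/-! ## §6 The colour average to second order -/

/-- ★★★ **Colour average of `exp(linear)` to second order.**  For `X₁(c) = Σ_k (Ad c a_k)·Y_k` with `|X₁| ≤ ε₁ ≤ 1`:
`|∫ exp X₁ dc - (1 + (1/6) Σ_{k,l} (a_k·a_l)(Y_k·Y_l))| ≤ (2/9) ε₁³`.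
Compare lane A's `haar_integral_exp_linear_sandwich` (`X₂ = 0`): `1 ≤ ∫ exp X₁ ≤ 1 + ε₁²`; the quadratic term
is genuinely present, with exact coefficient `1/6` of the form `Σ (a_k·a_l)(Y_k·Y_l)`. -/
theorem haar_integral_exp_linear_second_order {ι : Type*} [Fintype ι] (a Y : ι → Fin 3 → ℝ) {ε₁ : ℝ}
    (h1 : ∀ c : SU2, |∑ k, (adRot c *ᵥ a k) ⬝ᵥ Y k| ≤ ε₁) (hε : ε₁ ≤ 1) :
    |∫ c, exp (∑ k, (adRot c *ᵥ a k) ⬝ᵥ Y k) ∂haarProbability SU2 - (1 + (1/6 : ℝ) * ∑ k, ∑ l, (a k ⬝ᵥ a l) * (Y k ⬝ᵥ Y l))|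
      ≤ 2/9 * ε₁ ^ 3 := by
  haveI : SecondCountableTopology SU2 := secondCountableTopology_su2
  have hm : Measurable fun c : SU2 => ∑ k, (adRot c *ᵥ a k) ⬝ᵥ Y k :=
    (continuous_finsetSum _ fun k _ => continuous_adRot_dot (a k) (Y k)).measurable
  have hmean : ∫ c, ∑ k, (adRot c *ᵥ a k) ⬝ᵥ Y k ∂haarProbability SU2 = 0 := by
    rw [integral_finsetSum _ fun k _ => ?_]
    · simp [integral_adRot_mulVec_dotProduct_eq_zero]
    · exact integrable_of_measurable_abs_le _ (continuous_adRot_dot (a k) (Y k)).measurable (abs_adRot_dot_le' · (a k) (Y k))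
  have h := abs_integral_exp_sub_second_order (haarProbability SU2) hm h1 hε hmean
  rwa [integral_sq_sum_dot, ← mul_assoc, show (1/2 : ℝ) * (1/3) = 1/6 by norm_num] at h

/-- ★★★ Single-vector form: `|∫ exp((Ad c a)·Y) dc - (1 + (a·a)(Y·Y)/6)| ≤ (2/9) ε₁³` for `|(Ad c a)·Y| ≤ ε₁ ≤ 1`. -/
theorem haar_integral_exp_dot_second_order (a Y : Fin 3 → ℝ) {ε₁ : ℝ} (h1 : ∀ c : SU2, |(adRot c *ᵥ a) ⬝ᵥ Y| ≤ ε₁)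
    (hε : ε₁ ≤ 1) : |∫ c, exp ((adRot c *ᵥ a) ⬝ᵥ Y) ∂haarProbability SU2 - (1 + (a ⬝ᵥ a) * (Y ⬝ᵥ Y) / 6)| ≤ 2/9 * ε₁ ^ 3 := by
  have h := haar_integral_exp_linear_second_order (ι := Fin 1) (fun _ => a) (fun _ => Y) (ε₁ := ε₁)
    (fun c => by simpa using h1 c) hε
  simp only [Finset.univ_unique, Fin.default_eq_zero, Finset.sum_singleton] at h
  convert h using 3
  ring

/-! ## §7 Refuted sharpenings: the colour average is NOT constant beyond first order -/

/-- `(Ad c (t e₀))·e₀ = t·Ad(c)₀₀`. -/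
theorem adRot_e0_dot_e0 (c : SU2) (t : ℝ) : (adRot c *ᵥ ![t, 0, 0]) ⬝ᵥ ![1, 0, 0] = t * adRot c 0 0 := by
  simp [Matrix.mulVec, dotProduct, Fin.sum_univ_three]; ring

/-- `|(Ad c (t e₀))·e₀| ≤ t` for `0 ≤ t`. -/
theorem abs_adRot_e0_dot_e0_le (c : SU2) {t : ℝ} (ht : 0 ≤ t) : |(adRot c *ᵥ ![t, 0, 0]) ⬝ᵥ ![1, 0, 0]| ≤ t :=
  abs_adRot_dot_le c _ _ ht (by simp [Fin.sum_univ_three])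

/-- ★★ Explicit lower bound at `a = t e₀`, `Y = e₀`: `∫ exp(t·Ad(c)₀₀) dc ≥ 1 + t²/6 - (2/9)t³` (`0 ≤ t ≤ 1`). -/
theorem average_exp_e0_ge {t : ℝ} (ht0 : 0 ≤ t) (ht1 : t ≤ 1) :
    1 + t ^ 2 / 6 - 2/9 * t ^ 3 ≤ ∫ c, exp (t * adRot c 0 0) ∂haarProbability SU2 := by
  have h := haar_integral_exp_dot_second_order ![t, 0, 0] ![1, 0, 0] (fun c => abs_adRot_e0_dot_e0_le c ht0) ht1
  simp_rw [adRot_e0_dot_e0] at h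
  have hd : (![t, 0, 0] ⬝ᵥ ![t, 0, 0]) * (![(1:ℝ), 0, 0] ⬝ᵥ ![1, 0, 0]) / 6 = t ^ 2 / 6 := by
    simp [dotProduct, Fin.sum_univ_three]; ring
  rw [hd] at h
  have := (abs_le.mp h).1
  linarith

/-- ★★★ **Refuted sharpening 1** (no cubic closeness): it is FALSE that the colour average of `exp(t·Ad(c)₀₀)` is
`1 + O(t³)`; the quadratic term `t²/6` is really there.  Witness `t = 1/(6|K|+6)`. -/
theorem not_average_exp_cubic_close :
    ¬ ∃ K : ℝ, ∀ t : ℝ, 0 < t → t ≤ 1 → |∫ c, exp (t * adRot c 0 0) ∂haarProbability SU2 - 1| ≤ K * t ^ 3 := by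
  rintro ⟨K, hK⟩
  set t : ℝ := 1 / (6 * |K| + 6) with ht
  have ht0 : 0 < t := by rw [ht]; positivity
  have ht1 : t ≤ 1 := by rw [ht, div_le_one (by positivity)]; linarith [abs_nonneg K]
  have hlow := average_exp_e0_ge ht0.le ht1
  have hup := (abs_le.mp (hK t ht0 ht1)).2
  -- `t²/6 - (2/9)t³ ≤ K t³ ≤ |K| t³`, i.e. `1/6 ≤ (2/9 + |K|) t`, contradicting `t (6|K|+6) = 1`.
  have hKt : K * t ^ 3 ≤ |K| * t ^ 3 := mul_le_mul_of_nonneg_right (le_abs_self K) (by positivity)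
  have hprod : t * (6 * |K| + 6) = 1 := by rw [ht]; field_simp
  nlinarith [ht0, sq_nonneg t, mul_pos ht0 ht0]

/-- ★★★ **Refuted sharpening 2** (the sandwich's upper constant is sharp in order): it is FALSE that
`∫ exp((Ad c a)·Y) dc ≤ 1 + ε₁²/7` whenever `|(Ad c a)·Y| ≤ ε₁ ≤ 1`.  Witness `a = e₀/20`, `Y = e₀`, `ε₁ = 1/20`
(truth `≥ 1 + ε₁²(1/6 - (2/9)/20) > 1 + ε₁²/7`).  So lane A's `(ε₁+ε₂)²` slack is of the right ORDER: the
second-order term cannot be averaged away, only budgeted (`κ ≥ c·δ²`). -/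
theorem not_sandwich_upper_seventh :
    ¬ ∀ (a Y : Fin 3 → ℝ) (ε₁ : ℝ), (∀ c : SU2, |(adRot c *ᵥ a) ⬝ᵥ Y| ≤ ε₁) → ε₁ ≤ 1 →
      ∫ c, exp ((adRot c *ᵥ a) ⬝ᵥ Y) ∂haarProbability SU2 ≤ 1 + ε₁ ^ 2 / 7 := by
  intro h
  have hup := h ![1/20, 0, 0] ![1, 0, 0] (1/20) (fun c => abs_adRot_e0_dot_e0_le c (by norm_num)) (by norm_num)
  simp_rw [adRot_e0_dot_e0] at hup
  have hlow := average_exp_e0_ge (t := 1/20) (by norm_num) (by norm_num)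
  norm_num at hup hlow
  linarith


end Summit.QuantumFields.YangMills.Theorems.TwistedTraceScaling.Negative.R39

end
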